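import Mathlib.LinearAlgebra.Matrix.Basis
import Mathlib.LinearAlgebra.Determinant
import Literature.AlgebraicGeometry.RealAlgebraic.RealPointsKaehler
import Literature.AlgebraicGeometry.Motives.AlgPointsProperMapProofs
import Literature.AlgebraicGeometry.Resolution.MarkedIdeals
import Literature.AlgebraicGeometry.Resolution.RsopMonomialIdeals
import Literature.AlgebraicGeometry.Resolution.SncZeroLocusMonomial
import Literature.AlgebraicGeometry.Resolution.BlowupSNC
import Literature.AlgebraicGeometry.Motives.SmoothPiecesByDimension
import HarnessLib

/-!
# The Jacobian of a morphism of smooth `ℝ`-schemes at real points; monomial normal forms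

Let `Π : X' → X` be a morphism of `ℝ`-schemes, `U ⊆ X`, `U' ⊆ Π⁻¹U ⊆ X'` affine opens carrying
regular functions `x₁, …, xₙ ∈ Γ(X, U)`, `t'₁, …, t'ₙ ∈ Γ(X', U')` whose differentials are bases of
the Kähler differentials `Ω_{Γ(X,U)/ℝ}`, `Ω_{Γ(X',U')/ℝ}` (local frames; at smooth real points such
frames come from local coordinates, `RealPoints.exists_affineOpen_basis_kaehler`). The **algebraic
Jacobian matrix** of `Π` in these frames is `cᵢⱼ ∈ Γ(X', U')`, `d(Π^* xᵢ) = ∑ⱼ cᵢⱼ dt'ⱼ`, and its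
determinant `J = det(cᵢⱼ) ∈ Γ(X', U')`. This file proves:

* `mem_basicOpen_det_of_isIso_stalkMap` — **`J` is a unit at every point `q ∈ U'` at which `Π` is
  a local isomorphism** (`IsIso (Π.stalkMap q)`): in `Ω_{𝒪_{X',q}/ℝ}` both `(dt'ⱼ)` and
  `(d Π^*xᵢ)` are bases (Kähler differentials commute with localisation), and `(cᵢⱼ)` is the
  change-of-basis matrix (EGA IV₄ 17.11 / Görtz–Wedhorn I 6.28: étale ⇔ Jacobian invertible);
* `fderiv_chart_map_eq`, `det_fderiv_chart_map_eq_eval` — **the analytic Jacobian of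
  `Π(ℝ) : X'(ℝ) → X(ℝ)`** read in analytic algebraic charts with coordinates `t'`, `x` at a real
  point `Q` **is the matrix of values `(cᵢⱼ(Q))`, with determinant `J(Q)`**
  (`RealPoints.fderiv_chart_eq_sum`: analytic partial derivatives are the values of the algebraic
  ones);
* `exists_eval_mul_eq_mul_prod_pow` — **monomial normal form at a real point with a regular system
  of parameters**: if `𝒪_{X',p}` is regular with regular system of parameters the germs of
  `t'₁, …, t'ₙ` and a section `s ∈ Γ(X', U')` is a unit at every generization `q ⤳ p` outside the
  coordinate hyperplanes `{t'ⱼ = 0}`, `j ∈ S`, then `s · den = num · ∏_{j ∈ S} t'ⱼ^{kⱼ}` on `U'` with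
  `num(p), den(p) ≠ 0` — hence, at all real points near `p`, `s = (analytic unit) · ∏ t'ⱼ^{kⱼ}`
  (unique factorisation in the regular local ring `𝒪_{X',p}`, whose parameters are prime elements:
  the tree's `Resolution.exists_isUnit_mul_prod_pow_of_forall_prime_mem`);
* the dictionary used to feed it from a simple-normal-crossings resolution
  (`mem_primeIdealOf_of_mem_support_of_stalkIdeal_eq`, `specializes_iff_primeIdealOf_le`, …;
  `Resolution.mem_basicOpen_iff_not_mem_primeIdealOf` is reused from `BlowupSNC`).

These are the local algebraic inputs of the classical statement that a log resolution
`Π : X' → X` of `Z ⊂ X` (isomorphism off `Z`, `Π⁻¹Z` a simple normal crossings divisor) makes both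
`f ∘ Π` (for `f` vanishing only on `Z`) and the Jacobian determinant of `Π` locally monomial in
suitable coordinates at every point of `Π⁻¹Z` — the form of Hironaka's theorem used in the
asymptotic theory of Laplace integrals (Arnold–Gusein-Zade–Varchenko II §7.3, proof of Thm. 7.5;
Atiyah 1970; Watanabe 2009 Thm. 2.8), here for real algebraic (Nash) data.

Everything is proved; no named facts.

## References

* A. Grothendieck, *EGA* IV₄, 17.11.1–17.11.4, 17.15.5; U. Görtz, T. Wedhorn, *Algebraic
  Geometry I* (2nd ed. 2020), Thm. 6.28, Cor. 6.33. [GortzWedhorn2020]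
* V. I. Arnold, S. M. Gusein-Zade, A. N. Varchenko, *Singularities of Differentiable Maps* II
  (2012), Part II §7.3 (proof of Thm. 7.5: "resolution of singularities … in a neighbourhood of
  every point … `f ∘ π = ± y₁^{k₁} ⋯ yₙ^{kₙ}`, the Jacobian `= a(y) y₁^{m₁} ⋯ yₙ^{mₙ}`").
  [ArnoldGuseinzadeVarchenko2012]
* M. F. Atiyah, *Resolution of singularities and division of distributions*, Comm. Pure Appl.
  Math. 23 (1970), 145–150.
-/

noncomputable section

open scoped Manifold ContDiff Topology Matrix
open CategoryTheory AlgebraicGeometry Filter Set KaehlerDifferential IsLocalRing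
open Literature.AlgebraicGeometry.Motives
open Literature.AlgebraicGeometry.Motives.AlgPoints (evalOrZero evalOrZero_of_mem evalOrZero_of_not_mem)
open Literature.AlgebraicGeometry.Resolution

namespace Literature.AlgebraicGeometry.RealAlgebraic

namespace RealPoints

attribute [local instance] UniversalHyperplaneSection.sectionsAlgebra

universe u

/-! ### Scheme-theoretic bookkeeping -/

section Scheme

variable {k : Type u} [Field k] {X Y : SchemeOver k} {L : Type u} [Field L] [Algebra k L]

/-- The scalars of `Γ(X, U)` are the pull-backs of the scalars of `Γ(Y, V)` along a
`k`-morphism `f` (both come from `Γ(Spec k, 𝒪) = k`; `X → Spec k` factors through `f`).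
[folklore] -/
theorem scalarRingHom_eq_appLE' (f : X ⟶ Y) {V : Y.left.Opens} {U : X.left.Opens}
    (hle : U ≤ f.left ⁻¹ᵁ V) (c : k) :
    SchemeOver.scalarRingHom X U c = f.left.appLE V U hle (SchemeOver.scalarRingHom Y V c) := by
  rw [SchemeOver.scalarRingHom_apply, SchemeOver.scalarRingHom_apply]
  have h1 : f.left.appLE V U hle (Y.hom.appLE ⊤ V le_top ((Scheme.ΓSpecIso (.of k)).inv c)) =
      (Y.hom.appLE ⊤ V le_top ≫ f.left.appLE V U hle) ((Scheme.ΓSpecIso (.of k)).inv c) := rfl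
  rw [h1, Scheme.Hom.appLE_comp_appLE]
  have key : ∀ (g : X.left ⟶ Spec (.of k)) (_ : g = X.hom) (e' : U ≤ g ⁻¹ᵁ ⊤),
      g.appLE ⊤ U e' = X.hom.appLE ⊤ U le_top := by
    rintro _ rfl _; rfl
  rw [key _ (Over.w f)]

/-- Total evaluation of a pulled-back function on `U(L)`:
`evalOrZero U (f^* s) P = evalOrZero V s (f P)` for `P ∈ U(L)`, `U ⊆ f⁻¹V`. [folklore] -/
theorem evalOrZero_appLE' (f : X ⟶ Y) {V : Y.left.Opens} {U : X.left.Opens}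
    (hle : U ≤ f.left ⁻¹ᵁ V) (P : AlgPoints X L) (hPU : P.pt ∈ U) (s : Γ(Y.left, V)) :
    evalOrZero U (f.left.appLE V U hle s) P = evalOrZero V s (AlgPoints.map f P) := by
  rw [evalOrZero_of_mem _ hPU,
    evalOrZero_of_mem _ (show (AlgPoints.map f P).pt ∈ V from hle hPU),
    AlgPoints.eval_appLE_eq_eval_map]

end Scheme

section Affine

variable {X : Scheme.{u}}

/-- `primeIdealOf` inverts `fromSpec` on an affine open. [folklore] -/
theorem primeIdealOf_fromSpec {U : X.Opens} (hU : IsAffineOpen U) (y : PrimeSpectrum Γ(X, U)) :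
    hU.primeIdealOf ⟨hU.fromSpec y, hU.range_fromSpec.le ⟨y, rfl⟩⟩ = y := by
  apply hU.isoSpec.inv.homeomorph.injective
  change hU.isoSpec.inv (hU.isoSpec.hom _) = hU.isoSpec.inv y
  rw [← Scheme.Hom.comp_apply, Iso.hom_inv_id]
  apply Subtype.ext
  change _ = (hU.fromSpec y : X)
  rfl

/-- **Specialization inside an affine open is containment of primes.** [folklore] -/
theorem specializes_iff_primeIdealOf_le {q x : X} (U : X.affineOpens)
    (hq : q ∈ (U : X.Opens)) (hx : x ∈ (U : X.Opens)) :
    q ⤳ x ↔ (U.2.primeIdealOf ⟨q, hq⟩).asIdeal ≤ (U.2.primeIdealOf ⟨x, hx⟩).asIdeal := by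
  change _ ↔ U.2.primeIdealOf ⟨q, hq⟩ ≤ U.2.primeIdealOf ⟨x, hx⟩
  rw [PrimeSpectrum.le_iff_specializes]
  have h1 : q ⤳ x ↔ (⟨q, hq⟩ : ↥(U : X.Opens)) ⤳ (⟨x, hx⟩ : ↥(U : X.Opens)) :=
    (Topology.IsInducing.specializes_iff (f := ((↑) : ↥(U : X.Opens) → X))
      (x := (⟨q, hq⟩ : ↥(U : X.Opens))) (y := (⟨x, hx⟩ : ↥(U : X.Opens)))
      Topology.IsInducing.subtypeVal)
  rw [h1]
  constructor
  · intro h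
    exact h.map U.2.isoSpec.hom.homeomorph.continuous
  · intro h
    have := h.map U.2.isoSpec.inv.homeomorph.continuous
    have e1 : U.2.isoSpec.inv.homeomorph (U.2.primeIdealOf ⟨q, hq⟩) = ⟨q, hq⟩ := by
      change U.2.isoSpec.inv (U.2.isoSpec.hom _) = _
      rw [← Scheme.Hom.comp_apply, Iso.hom_inv_id]; rfl
    have e2 : U.2.isoSpec.inv.homeomorph (U.2.primeIdealOf ⟨x, hx⟩) = ⟨x, hx⟩ := by
      change U.2.isoSpec.inv (U.2.isoSpec.hom _) = _
      rw [← Scheme.Hom.comp_apply, Iso.hom_inv_id]; rfl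
    rwa [e1, e2] at this

/-- **Supports of ideal sheaves and primes of generizations.** Let `U ∋ x` be affine, `q ∈ U` a
generization of `x` lying in the support of the ideal sheaf `D`, and suppose the stalk `D_x` is
the principal ideal generated by the germ of the section `t ∈ Γ(X, U)`. Then `t` lies in the
prime of `q`. [folklore] -/
theorem mem_primeIdealOf_of_mem_support_of_stalkIdeal_eq {x q : X} (U : X.affineOpens)
    (hx : x ∈ (U : X.Opens)) (hq : q ∈ (U : X.Opens)) (hqx : q ⤳ x) (D : X.IdealSheafData)
    (hqD : q ∈ D.support) (t : Γ(X, U))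
    (ht : stalkIdeal D x = Ideal.span {(X.presheaf.germ U x hx).hom t}) :
    t ∈ (U.2.primeIdealOf ⟨q, hq⟩).asIdeal := by
  letI alg : Algebra Γ(X, U) (X.presheaf.stalk x) := (X.presheaf.germ U x hx).hom.toAlgebra
  set 𝔭 := (U.2.primeIdealOf ⟨x, hx⟩).asIdeal with h𝔭
  set 𝔮 := (U.2.primeIdealOf ⟨q, hq⟩).asIdeal with h𝔮
  haveI : IsLocalization.AtPrime (X.presheaf.stalk x) 𝔭 := U.2.isLocalization_stalk ⟨x, hx⟩
  -- `D(U) ⊆ 𝔮`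
  have hDq : D.ideal U ≤ 𝔮 := by
    intro g hg
    have hz := (Scheme.IdealSheafData.mem_support_iff_of_mem (I := D) (U := U) hq).1 hqD
    rw [Scheme.mem_zeroLocus_iff] at hz
    have := hz g hg
    rwa [mem_basicOpen_iff_not_mem_primeIdealOf U hq g, not_not] at this
  -- `germ t ∈ D_x = D(U) 𝒪_x ⊆ 𝔮 𝒪_x`
  have h1 : (X.presheaf.germ U x hx).hom t ∈ Ideal.map (algebraMap Γ(X, U) (X.presheaf.stalk x)) 𝔮 := by
    have : (X.presheaf.germ U x hx).hom t ∈ stalkIdeal D x := by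
      rw [ht]; exact Ideal.mem_span_singleton_self _
    rw [stalkIdeal_eq_map_germ D U hx] at this
    exact Ideal.map_mono hDq this
  -- contract: `𝔮 ⊆ 𝔭` is prime and disjoint from `Γ(X,U) ∖ 𝔭`
  have hle : 𝔮 ≤ 𝔭 := (specializes_iff_primeIdealOf_le U hq hx).1 hqx
  have hdisj : Disjoint (𝔭.primeCompl : Set Γ(X, U)) ↑𝔮 := by
    rw [Set.disjoint_left]; intro y hy hyq; exact hy (hle hyq)
  have key := IsLocalization.under_map_of_isPrime_disjoint 𝔭.primeCompl (X.presheaf.stalk x)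
    (U.2.primeIdealOf ⟨q, hq⟩).isPrime hdisj
  have h2 : t ∈ (Ideal.map (algebraMap Γ(X, U) (X.presheaf.stalk x)) 𝔮).under Γ(X, U) := h1
  rw [h𝔮] at h2 ⊢
  rw [key] at h2
  exact h2

end Affine

/-! ### The algebraic Jacobian is a unit where the morphism is a local isomorphism -/

section Jacobian

variable {X X' : SchemeOver ℝ} (π : X' ⟶ X) {n : ℕ}
  (U : X.left.affineOpens) (U' : X'.left.affineOpens)
  (hle : (↑U' : X'.left.Opens) ≤ π.left ⁻¹ᵁ ↑U)
  (x : Fin n → Γ(X.left, ↑U)) (t' : Fin n → Γ(X'.left, ↑U'))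
  (bU : Module.Basis (Fin n) Γ(X.left, ↑U) Ω[Γ(X.left, ↑U)⁄ℝ])
  (hbU : ∀ i, bU i = D ℝ Γ(X.left, ↑U) (x i))
  (bU' : Module.Basis (Fin n) Γ(X'.left, ↑U') Ω[Γ(X'.left, ↑U')⁄ℝ])
  (hbU' : ∀ j, bU' j = D ℝ Γ(X'.left, ↑U') (t' j))

/-- **The stalk at a point where `π` is a local isomorphism is a localisation of the sections
downstairs, through `π^*`.** For `q ∈ U' ⊆ π⁻¹U` with `π_q^♯ : 𝒪_{X,π q} ≅ 𝒪_{X',q}` an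
isomorphism, `Γ(X, U) → Γ(X', U') → 𝒪_{X',q}` is the localisation of `Γ(X, U)` at the prime of
`π q`. [folklore] -/
theorem isLocalization_stalk_of_isIso_stalkMap (q : X'.left) (hq : q ∈ (↑U' : X'.left.Opens))
    [IsIso (π.left.stalkMap q)] :
    letI : Algebra Γ(X.left, ↑U) (X'.left.presheaf.stalk q) :=
      ((X'.left.presheaf.germ ↑U' q hq).hom.comp (π.left.appLE ↑U ↑U' hle).hom).toAlgebra
    IsLocalization.AtPrime (X'.left.presheaf.stalk q)
      (U.2.primeIdealOf ⟨π.left q, hle hq⟩).asIdeal := by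
  have hπq : π.left q ∈ (↑U : X.left.Opens) := hle hq
  letI algT : Algebra Γ(X.left, ↑U) (X.left.presheaf.stalk (π.left q)) :=
    (X.left.presheaf.germ ↑U (π.left q) hπq).hom.toAlgebra
  haveI : IsLocalization.AtPrime (X.left.presheaf.stalk (π.left q))
      (U.2.primeIdealOf ⟨π.left q, hπq⟩).asIdeal := U.2.isLocalization_stalk ⟨π.left q, hπq⟩
  set h : X.left.presheaf.stalk (π.left q) ≃+* X'.left.presheaf.stalk q :=
    (asIso (π.left.stalkMap q)).commRingCatIsoToRingEquiv with hh
  have key : h.toRingHom.comp (algebraMap Γ(X.left, ↑U) (X.left.presheaf.stalk (π.left q))) =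
      (X'.left.presheaf.germ ↑U' q hq).hom.comp (π.left.appLE ↑U ↑U' hle).hom := by
    refine RingHom.ext fun a => ?_
    change π.left.stalkMap q (X.left.presheaf.germ ↑U (π.left q) hπq a) =
      X'.left.presheaf.germ ↑U' q hq (π.left.appLE ↑U ↑U' hle a)
    rw [Scheme.Hom.germ_stalkMap_apply]
    change _ = X'.left.presheaf.germ ↑U' q hq
      ((π.left.app ↑U ≫ X'.left.presheaf.map (homOfLE hle).op) a)
    rw [CommRingCat.comp_apply, TopCat.Presheaf.germ_res_apply X'.left.presheaf]
  have := (IsLocalization.isLocalization_iff_of_ringEquiv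
    (U.2.primeIdealOf ⟨π.left q, hπq⟩).asIdeal.primeCompl h).1 inferInstance
  rw [key] at this
  exact this

include hbU in
/-- **The Jacobian determinant of `π` is a unit at every point where `π` is a local
isomorphism.** Let `(dxᵢ)` and `(dt'ⱼ)` be bases of `Ω_{Γ(X,U)/ℝ}`, `Ω_{Γ(X',U')/ℝ}` and
`cᵢⱼ ∈ Γ(X', U')` the coordinates `d(π^*xᵢ) = ∑ⱼ cᵢⱼ dt'ⱼ`. If `q ∈ U'` and the stalk map
`𝒪_{X,π q} → 𝒪_{X',q}` is an isomorphism, then `det(cᵢⱼ)` is a unit at `q`: in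
`Ω_{𝒪_{X',q}/ℝ}` (the localisation of both modules of differentials) `(dt'ⱼ)` and `(dπ^*xᵢ)` are
two bases and `(cᵢⱼ)` is the change-of-basis matrix. (Görtz–Wedhorn I Thm. 6.28 / EGA IV₄
17.11.2: the Jacobian criterion for étaleness, easy direction.) [cite: GortzWedhorn2020, Thm. 6.28] -/
theorem mem_basicOpen_det_of_isIso_stalkMap (q : X'.left) (hq : q ∈ (↑U' : X'.left.Opens))
    [IsIso (π.left.stalkMap q)] :
    q ∈ X'.left.basicOpen (Matrix.det (Matrix.of fun i j =>
      bU'.repr (D ℝ Γ(X'.left, ↑U') (π.left.appLE ↑U ↑U' hle (x i))) j)) := by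
  classical
  have hπq : π.left q ∈ (↑U : X.left.Opens) := hle hq
  -- notation for the stalk and its algebra structures
  letI algA'S : Algebra Γ(X'.left, ↑U') (X'.left.presheaf.stalk q) :=
    (X'.left.presheaf.germ ↑U' q hq).hom.toAlgebra
  letI algRS : Algebra ℝ (X'.left.presheaf.stalk q) :=
    ((X'.left.presheaf.germ ↑U' q hq).hom.comp (SchemeOver.scalarRingHom X' ↑U')).toAlgebra
  haveI towA' : IsScalarTower ℝ Γ(X'.left, ↑U') (X'.left.presheaf.stalk q) :=
    IsScalarTower.of_algebraMap_eq' rfl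
  set 𝔮 := (U'.2.primeIdealOf ⟨q, hq⟩).asIdeal with h𝔮
  haveI : IsLocalization.AtPrime (X'.left.presheaf.stalk q) 𝔮 := U'.2.isLocalization_stalk ⟨q, hq⟩
  -- upstairs basis of `Ω_{𝒪_q/ℝ}`
  set βu : Module.Basis (Fin n) (X'.left.presheaf.stalk q) Ω[X'.left.presheaf.stalk q⁄ℝ] :=
    bU'.ofIsLocalizedModule (X'.left.presheaf.stalk q) 𝔮.primeCompl
      (KaehlerDifferential.map ℝ ℝ Γ(X'.left, ↑U') (X'.left.presheaf.stalk q)) with hβu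
  -- downstairs ring acting through `π^*`
  letI algAS : Algebra Γ(X.left, ↑U) (X'.left.presheaf.stalk q) :=
    ((X'.left.presheaf.germ ↑U' q hq).hom.comp (π.left.appLE ↑U ↑U' hle).hom).toAlgebra
  haveI towA : IsScalarTower ℝ Γ(X.left, ↑U) (X'.left.presheaf.stalk q) := by
    refine IsScalarTower.of_algebraMap_eq' (RingHom.ext fun c => ?_)
    change (X'.left.presheaf.germ ↑U' q hq).hom (SchemeOver.scalarRingHom X' ↑U' c) =
      (X'.left.presheaf.germ ↑U' q hq).hom (π.left.appLE ↑U ↑U' hle (SchemeOver.scalarRingHom X ↑U c))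
    rw [← scalarRingHom_eq_appLE' π hle c]
  set 𝔭 := (U.2.primeIdealOf ⟨π.left q, hπq⟩).asIdeal with h𝔭
  haveI : IsLocalization.AtPrime (X'.left.presheaf.stalk q) 𝔭 :=
    isLocalization_stalk_of_isIso_stalkMap π U U' hle q hq
  set βx : Module.Basis (Fin n) (X'.left.presheaf.stalk q) Ω[X'.left.presheaf.stalk q⁄ℝ] :=
    bU.ofIsLocalizedModule (X'.left.presheaf.stalk q) 𝔭.primeCompl
      (KaehlerDifferential.map ℝ ℝ Γ(X.left, ↑U) (X'.left.presheaf.stalk q)) with hβx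
  -- the matrix
  set c : Fin n → Fin n → Γ(X'.left, ↑U') := fun i j =>
    bU'.repr (D ℝ Γ(X'.left, ↑U') (π.left.appLE ↑U ↑U' hle (x i))) j with hc
  -- expansions
  have hβu_apply : ∀ j, βu j = KaehlerDifferential.map ℝ ℝ Γ(X'.left, ↑U') (X'.left.presheaf.stalk q) (bU' j) :=
    fun j => Module.Basis.ofIsLocalizedModule_apply _ _ _ _ j
  have hexp : ∀ i, βx i = ∑ j, algebraMap Γ(X'.left, ↑U') (X'.left.presheaf.stalk q) (c i j) • βu j := by
    intro i
    rw [hβx, Module.Basis.ofIsLocalizedModule_apply, hbU, KaehlerDifferential.map_D]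
    have h1 : algebraMap Γ(X.left, ↑U) (X'.left.presheaf.stalk q) (x i) =
        algebraMap Γ(X'.left, ↑U') (X'.left.presheaf.stalk q) (π.left.appLE ↑U ↑U' hle (x i)) := rfl
    rw [h1, ← KaehlerDifferential.map_D ℝ ℝ Γ(X'.left, ↑U') (X'.left.presheaf.stalk q),
      ← bU'.sum_repr (D ℝ Γ(X'.left, ↑U') (π.left.appLE ↑U ↑U' hle (x i))), map_sum]
    refine Finset.sum_congr rfl fun j _ => ?_
    rw [LinearMap.map_smul_of_tower, hβu_apply, algebraMap_smul]
  -- the change-of-basis matrix is `(algebraMap c)` (transposed), hence has unit determinant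
  have hmat : βu.toMatrix βx = (Matrix.of fun i j =>
      algebraMap Γ(X'.left, ↑U') (X'.left.presheaf.stalk q) (c i j))ᵀ := by
    ext j i
    rw [Module.Basis.toMatrix_apply, hexp i, βu.repr_sum_self]
    rfl
  have hunit : IsUnit (βu.toMatrix βx).det := by
    letI := βu.invertibleToMatrix βx
    exact Matrix.isUnit_det_of_invertible _
  rw [hmat, Matrix.det_transpose] at hunit
  have hmap : (Matrix.of fun i j => algebraMap Γ(X'.left, ↑U') (X'.left.presheaf.stalk q) (c i j)) =
      (algebraMap Γ(X'.left, ↑U') (X'.left.presheaf.stalk q)).mapMatrix (Matrix.of c) := by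
    ext i j; rfl
  rw [hmap, ← RingHom.map_det] at hunit
  -- conclude
  rw [Scheme.mem_basicOpen (hx := hq)]
  exact hunit

end Jacobian

/-! ### The analytic Jacobian of `Π(ℝ)` in algebraic charts is the value of the algebraic one -/

section Analytic

variable {X X' : SchemeOver ℝ} (π : X' ⟶ X) {n : ℕ}
  (U : X.left.affineOpens) (U' : X'.left.affineOpens)
  (hle : (↑U' : X'.left.Opens) ≤ π.left ⁻¹ᵁ ↑U)
  (x : Fin n → Γ(X.left, ↑U)) (t' : Fin n → Γ(X'.left, ↑U'))
  (bU' : Module.Basis (Fin n) Γ(X'.left, ↑U') Ω[Γ(X'.left, ↑U')⁄ℝ])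
  (hbU' : ∀ j, bU' j = D ℝ Γ(X'.left, ↑U') (t' j))
  (φ' : OpenPartialHomeomorph (AlgPoints X' ℝ) (Fin n → ℝ))
  (hol' : ∀ (V : X'.left.affineOpens) (s : Γ(X'.left, ↑V)),
    AnalyticOnNhd ℝ (evalOrZero ↑V s ∘ φ'.symm)
      (φ'.target ∩ φ'.symm ⁻¹' {P | P.pt ∈ (↑V : X'.left.Opens)}))
  (hφ'U : φ'.source ⊆ {P | P.pt ∈ (↑U' : X'.left.Opens)})
  (hφ't : ∀ P ∈ φ'.source, ∀ j, φ' P j = evalOrZero ↑U' (t' j) P)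
  (ξ : OpenPartialHomeomorph (AlgPoints X ℝ) (Fin n → ℝ))
  (hξx : ∀ P ∈ ξ.source, ∀ i, ξ P i = evalOrZero ↑U (x i) P)

include hbU' hol' hφ'U hφ't hξx in
/-- **The differential of `Π(ℝ)` in algebraic charts.** Let `φ'` be an analytic algebraic chart of
`X'(ℝ)` with coordinates `t'` (`φ'.source ⊆ U'(ℝ)`), `ξ` a chart of `X(ℝ)` with coordinates `x`
on its source, `(dt'ⱼ)` a basis of `Ω_{Γ(X',U')/ℝ}` and `cᵢⱼ` the coordinates of `d(Π^*xᵢ)`. Then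
at every `Q ∈ φ'.source` with `Π(Q) ∈ ξ.source`, the chart expression `ξ ∘ Π(ℝ) ∘ φ'⁻¹` has
differential the matrix of values `(cᵢⱼ(Q))` (its `i`-th component is `Π^*xᵢ` read in `φ'`, whose
partial derivatives are the `cᵢⱼ(Q)`, `RealPoints.fderiv_chart_eq_sum`).
[cite: SerreGAGA1956, §2 n°6 Prop. 3] -/
theorem hasFDerivAt_chart_map {Q : AlgPoints X' ℝ} (hQ : Q ∈ φ'.source)
    (hπQ : AlgPoints.map π Q ∈ ξ.source) :
    HasFDerivAt (ξ ∘ AlgPoints.map π ∘ φ'.symm)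
      (LinearMap.toContinuousLinearMap (Matrix.toLin' (Matrix.of fun i j =>
        Q.eval ↑U' (hφ'U hQ)
          (bU'.repr (D ℝ Γ(X'.left, ↑U') (π.left.appLE ↑U ↑U' hle (x i))) j))))
      (φ' Q) := by
  classical
  have hQU' : Q.pt ∈ (↑U' : X'.left.Opens) := hφ'U hQ
  set c : Fin n → Fin n → Γ(X'.left, ↑U') := fun i j =>
    bU'.repr (D ℝ Γ(X'.left, ↑U') (π.left.appLE ↑U ↑U' hle (x i))) j with hc
  -- near `φ' Q` the `i`-th component is `Π^* xᵢ` read in `φ'`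
  have hcont : ContinuousAt (AlgPoints.map π ∘ φ'.symm) (φ' Q) :=
    ((AlgPoints.continuous_map π).continuousAt).comp
      (φ'.continuousAt_symm (φ'.map_source hQ))
  have hev : ∀ᶠ u in 𝓝 (φ' Q), u ∈ φ'.target ∧ AlgPoints.map π (φ'.symm u) ∈ ξ.source := by
    filter_upwards [φ'.open_target.mem_nhds (φ'.map_source hQ),
      hcont.preimage_mem_nhds (ξ.open_source.mem_nhds (by
        simp only [Function.comp_apply, φ'.left_inv hQ]; exact hπQ))] with u hu hu'
    exact ⟨hu, hu'⟩
  have heq : (ξ ∘ AlgPoints.map π ∘ φ'.symm) =ᶠ[𝓝 (φ' Q)]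
      fun u i => evalOrZero ↑U' (π.left.appLE ↑U ↑U' hle (x i)) (φ'.symm u) := by
    filter_upwards [hev] with u hu
    funext i
    simp only [Function.comp_apply]
    rw [hξx _ hu.2 i, evalOrZero_appLE' π hle _ (hφ'U (φ'.map_target hu.1))]
  refine HasFDerivAt.congr_of_eventuallyEq ?_ heq
  -- differentiate each component
  have hcomp : ∀ i, HasFDerivAt
      (fun u => evalOrZero ↑U' (π.left.appLE ↑U ↑U' hle (x i)) (φ'.symm u))
      (∑ j, Q.eval ↑U' hQU' (c i j) • (ContinuousLinearMap.proj j : (Fin n → ℝ) →L[ℝ] ℝ))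
      (φ' Q) := by
    intro i
    have hd := (differentiableAt_chart φ' hQ hol' U' hQU'
      (π.left.appLE ↑U ↑U' hle (x i))).hasFDerivAt
    rw [fderiv_chart_eq_sum φ' hQ hol' U' hQU' bU' t' hbU' (π.left.appLE ↑U ↑U' hle (x i))] at hd
    have hcoord : ∀ j, fderiv ℝ (evalOrZero ↑U' (t' j) ∘ φ'.symm) (φ' Q) =
        (ContinuousLinearMap.proj j : (Fin n → ℝ) →L[ℝ] ℝ) :=
      fun j => fderiv_chart_coord φ' hQ U' t' hφ't j
    simp only [hcoord] at hd
    exact hd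
  have hpi := hasFDerivAt_pi.2 hcomp
  have hL : (LinearMap.toContinuousLinearMap (Matrix.toLin' (Matrix.of fun i j =>
      Q.eval ↑U' (hφ'U hQ) (c i j))) : (Fin n → ℝ) →L[ℝ] (Fin n → ℝ)) =
      ContinuousLinearMap.pi fun i =>
        ∑ j, Q.eval ↑U' hQU' (c i j) • (ContinuousLinearMap.proj j : (Fin n → ℝ) →L[ℝ] ℝ) := by
    ext v i
    simp only [LinearMap.coe_toContinuousLinearMap', Matrix.toLin'_apply,
      ContinuousLinearMap.pi_apply, FunLike.coe_sum, Finset.sum_apply, FunLike.coe_smul,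
      Pi.smul_apply, ContinuousLinearMap.proj_apply, smul_eq_mul, Matrix.mulVec, dotProduct,
      Matrix.of_apply]
  rw [hL]
  exact hpi

include hbU' hol' hφ'U hφ't hξx in
/-- **The analytic Jacobian determinant is the value of the algebraic one**: under the hypotheses
of `hasFDerivAt_chart_map`, `det d(ξ ∘ Π(ℝ) ∘ φ'⁻¹)(φ' Q) = J(Q)` with
`J = det(cᵢⱼ) ∈ Γ(X', U')`. [cite: SerreGAGA1956, §2 n°6 Prop. 3] -/
theorem det_fderiv_chart_map_eq_eval {Q : AlgPoints X' ℝ} (hQ : Q ∈ φ'.source)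
    (hπQ : AlgPoints.map π Q ∈ ξ.source) :
    (fderiv ℝ (ξ ∘ AlgPoints.map π ∘ φ'.symm) (φ' Q)).det =
      Q.eval ↑U' (hφ'U hQ) (Matrix.det (Matrix.of fun i j =>
        bU'.repr (D ℝ Γ(X'.left, ↑U') (π.left.appLE ↑U ↑U' hle (x i))) j)) := by
  classical
  rw [(hasFDerivAt_chart_map π U U' hle x t' bU' hbU' φ' hol' hφ'U hφ't ξ hξx hQ hπQ).fderiv,
    ContinuousLinearMap.det, LinearMap.coe_toContinuousLinearMap, LinearMap.det_toLin',
    ← AlgPoints.evalRingHom_apply, RingHom.map_det]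
  rfl

end Analytic

/-! ### Monomial normal forms at a real point with a regular system of parameters -/

section Monomial

variable {X : SchemeOver ℝ} {n : ℕ}

/-- **The embedding dimension at a real point of a smooth `n`-dimensional `ℝ`-scheme is `n`**
(the local ring is the localisation of a standard smooth chart at a rational maximal ideal,
regular of dimension `n`). [cite: GortzWedhorn2020, Lemma 6.26] -/
theorem spanFinrank_maximalIdeal_stalk_eq [SmoothOfRelativeDimension n X.hom] (Q : AlgPoints X ℝ)
    (hreg : IsRegularLocalRing (X.left.presheaf.stalk Q.pt)) :
    (maximalIdeal (X.left.presheaf.stalk Q.pt)).spanFinrank = n := by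
  obtain ⟨V, hV, hQV, hsm⟩ :=
    AlgPoints.exists_isStandardSmoothOfRelativeDimension_scalarRingHom n Q
  have hdim := ringKrullDim_stalk_eq_of_isStandardSmoothOfRelativeDimension hV hsm Q hQV
  have h := hreg.spanFinrank_maximalIdeal
  rw [hdim] at h
  exact_mod_cast h

/-- **Monomial normal form at a real point.** Let `p ∈ U'(ℝ)`, `U'` affine, with `𝒪_{X',p}` a
regular local ring whose maximal ideal is generated by the germs of `t'₁, …, t'ₙ ∈ Γ(X', U')`
(`n` its embedding dimension), and let `s ∈ Γ(X', U')`. Suppose that every generization `q ⤳ p`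
in `U'` at which `s` is not a unit lies on one of the coordinate hyperplanes `{t'ⱼ = 0}`, `j ∈ S`
(i.e. `t'ⱼ` lies in the prime of `q`). Then there are exponents `kⱼ` (`kⱼ = 0` for `j ∉ S`) and
sections `num`, `den` not vanishing at `p` with `s · den = num · ∏ⱼ t'ⱼ^{kⱼ}` in `Γ(X', U')`; in
particular `s(Q) · den(Q) = num(Q) · ∏ⱼ t'ⱼ(Q)^{kⱼ}` at every real point `Q` of `U'`. Proof: in the
UFD `𝒪_{X',p}` the parameters are prime elements and every prime divisor of the germ of `s` is
one of them (unique factorisation; the tree's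
`Resolution.exists_isUnit_mul_prod_pow_of_forall_prime_mem`); clear denominators.
[cite: ArnoldGuseinzadeVarchenko2012, Part II §7.3, proof of Thm. 7.5] -/
theorem exists_mul_eq_mul_prod_pow (p : AlgPoints X ℝ) (U' : X.left.affineOpens)
    (hp : p.pt ∈ (↑U' : X.left.Opens)) (hreg : IsRegularLocalRing (X.left.presheaf.stalk p.pt))
    (t' : Fin n → Γ(X.left, ↑U'))
    (hspan : Ideal.span (Set.range fun j => (X.left.presheaf.germ ↑U' p.pt hp).hom (t' j)) =
      maximalIdeal (X.left.presheaf.stalk p.pt))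
    (hfin : (maximalIdeal (X.left.presheaf.stalk p.pt)).spanFinrank = n)
    (s : Γ(X.left, ↑U')) (S : Set (Fin n))
    (H : ∀ (q : X.left) (hq : q ∈ (↑U' : X.left.Opens)), q ⤳ p.pt → q ∉ X.left.basicOpen s →
      ∃ j ∈ S, t' j ∈ (U'.2.primeIdealOf ⟨q, hq⟩).asIdeal) :
    ∃ (k : Fin n → ℕ) (num den : Γ(X.left, ↑U')), (∀ j ∉ S, k j = 0) ∧
      p.eval ↑U' hp num ≠ 0 ∧ p.eval ↑U' hp den ≠ 0 ∧
      s * den = num * ∏ j, t' j ^ k j := by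
  classical
  letI alg : Algebra Γ(X.left, ↑U') (X.left.presheaf.stalk p.pt) :=
    (X.left.presheaf.germ ↑U' p.pt hp).hom.toAlgebra
  set 𝔭 := (U'.2.primeIdealOf ⟨p.pt, hp⟩).asIdeal with h𝔭
  haveI : IsLocalization.AtPrime (X.left.presheaf.stalk p.pt) 𝔭 := U'.2.isLocalization_stalk ⟨p.pt, hp⟩
  haveI := hreg
  haveI : IsDomain (X.left.presheaf.stalk p.pt) := isDomain_of_isRegularLocalRing _
  have hker := ker_evalRingHom_eq_primeIdealOf p U' hp
  have hger : ∀ a : Γ(X.left, ↑U'), algebraMap Γ(X.left, ↑U') (X.left.presheaf.stalk p.pt) a =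
      (X.left.presheaf.germ ↑U' p.pt hp).hom a := fun a => rfl
  -- the parameters are prime elements
  set u : Fin n → X.left.presheaf.stalk p.pt := fun j => (X.left.presheaf.germ ↑U' p.pt hp).hom (t' j)
    with hu
  have hrsop : IsRsopPart u := by
    have := isRsopPart_comp_of_rsop hfin u hspan _root_.id Function.injective_id
    simpa using this
  -- unique factorisation in `𝒪_p` with the primes `u j`, `j ∈ S`
  let ι := {j : Fin n // j ∈ S}
  have hz : ∀ i : ι, Prime (u i.1) := fun i => hrsop.prime i.1
  have hH : ∀ 𝔮 : Ideal (X.left.presheaf.stalk p.pt), 𝔮.IsPrime →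
      algebraMap Γ(X.left, ↑U') _ s ∈ 𝔮 → ∃ i : ι, u i.1 ∈ 𝔮 := by
    intro 𝔮 h𝔮 hs𝔮
    -- the point `q ⤳ p` of `U'` corresponding to `𝔮`
    set 𝔮A : Ideal Γ(X.left, ↑U') := 𝔮.comap (algebraMap Γ(X.left, ↑U') (X.left.presheaf.stalk p.pt))
      with h𝔮A
    haveI : 𝔮A.IsPrime := Ideal.IsPrime.comap _
    have hle𝔭 : 𝔮A ≤ 𝔭 := by
      intro a ha
      by_contra hna
      have hunit : IsUnit (algebraMap Γ(X.left, ↑U') (X.left.presheaf.stalk p.pt) a) :=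
        IsLocalization.map_units (X.left.presheaf.stalk p.pt)
          (⟨a, show a ∈ 𝔭.primeCompl from hna⟩ : 𝔭.primeCompl)
      exact h𝔮.ne_top (Ideal.eq_top_of_isUnit_mem _ ha hunit)
    set y : PrimeSpectrum Γ(X.left, ↑U') := ⟨𝔮A, inferInstance⟩ with hy
    set q : X.left := U'.2.fromSpec y with hqdef
    have hq : q ∈ (↑U' : X.left.Opens) := U'.2.range_fromSpec.le ⟨y, rfl⟩
    have hprime : U'.2.primeIdealOf ⟨q, hq⟩ = y := primeIdealOf_fromSpec U'.2 y
    have hqp : q ⤳ p.pt := by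
      rw [specializes_iff_primeIdealOf_le U' hq hp, hprime]
      exact hle𝔭
    have hqs : q ∉ X.left.basicOpen s := by
      rw [mem_basicOpen_iff_not_mem_primeIdealOf U' hq s, hprime, not_not]
      exact hs𝔮
    obtain ⟨j, hjS, hj⟩ := H q hq hqp hqs
    rw [hprime] at hj
    exact ⟨⟨j, hjS⟩, hj⟩
  have hs0 : algebraMap Γ(X.left, ↑U') (X.left.presheaf.stalk p.pt) s ≠ 0 := by
    intro h0
    obtain ⟨i, hi⟩ := hH ⊥ Ideal.isPrime_bot (by rw [h0]; exact Submodule.zero_mem _)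
    exact (hz i).ne_zero ((Submodule.mem_bot _).1 hi)
  obtain ⟨v, k, hv, hfac⟩ := exists_isUnit_mul_prod_pow_of_forall_prime_mem
    (fun i : ι => u i.1) hz hs0 hH
  -- clear denominators: `v = germ a₁ / germ g₁`
  obtain ⟨a₁, g₁, hvq⟩ := IsLocalization.exists_mk'_eq 𝔭.primeCompl v
  have ha₁ : a₁ ∉ 𝔭 := by
    intro ha
    rw [← hvq] at hv
    exact ((IsLocalization.AtPrime.isUnit_mk'_iff (X.left.presheaf.stalk p.pt) 𝔭 a₁ g₁).1 hv) ha
  -- extend the exponents by zero off `S`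
  set k' : Fin n → ℕ := fun j => if h : j ∈ S then k ⟨j, h⟩ else 0 with hk'
  have hprod : (∏ i : ι, u i.1 ^ k i) = ∏ j, u j ^ k' j := by
    have h1 : ∏ j, u j ^ k' j = ∏ j ∈ Finset.univ.filter (· ∈ S), u j ^ k' j := by
      rw [← Finset.prod_filter_mul_prod_filter_not Finset.univ (· ∈ S)]
      have h2 : ∏ j ∈ Finset.univ.filter (fun j => ¬ j ∈ S), u j ^ k' j = 1 :=
        Finset.prod_eq_one fun j hj => by
          rw [Finset.mem_filter] at hj
          simp [hk', hj.2]
      rw [h2, mul_one]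
    rw [h1, Finset.prod_subtype (p := (· ∈ S)) (Finset.univ.filter (· ∈ S)) (fun j => by simp)
      (fun j => u j ^ k' j)]
    refine Finset.prod_congr rfl fun i _ => ?_
    simp [hk', i.2]
  -- the identity of germs `germ(s) germ(g₁) = germ(a₁) ∏ germ(t')^k'`
  have hgerm : algebraMap Γ(X.left, ↑U') (X.left.presheaf.stalk p.pt) (s * g₁) =
      algebraMap Γ(X.left, ↑U') (X.left.presheaf.stalk p.pt) (a₁ * ∏ j, t' j ^ k' j) := by
    rw [map_mul, map_mul, map_prod, hfac, ← hvq, hprod]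
    simp only [map_pow]
    have : IsLocalization.mk' (X.left.presheaf.stalk p.pt) a₁ g₁ * algebraMap _ _ (g₁ : Γ(X.left, ↑U')) =
        algebraMap _ _ a₁ := IsLocalization.mk'_spec _ a₁ g₁
    calc IsLocalization.mk' (X.left.presheaf.stalk p.pt) a₁ g₁ * (∏ j, u j ^ k' j) *
          algebraMap _ _ (g₁ : Γ(X.left, ↑U'))
        = (IsLocalization.mk' (X.left.presheaf.stalk p.pt) a₁ g₁ * algebraMap _ _ (g₁ : Γ(X.left, ↑U'))) *
            ∏ j, u j ^ k' j := by ring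
      _ = algebraMap _ _ a₁ * ∏ j, u j ^ k' j := by rw [this]
  obtain ⟨⟨h, hh⟩, hhsec⟩ := (IsLocalization.eq_iff_exists 𝔭.primeCompl _).1 hgerm
  refine ⟨k', h * a₁, h * g₁, fun j hj => by simp [hk', hj], ?_, ?_, ?_⟩
  · rw [← AlgPoints.evalRingHom_apply, map_mul]
    refine mul_ne_zero ?_ ?_
    · intro h0
      have hm : h ∈ RingHom.ker (p.evalRingHom ↑U' hp) := h0
      rw [hker] at hm
      exact hh hm
    · intro h0
      have hm : a₁ ∈ RingHom.ker (p.evalRingHom ↑U' hp) := h0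
      rw [hker] at hm
      exact ha₁ hm
  · rw [← AlgPoints.evalRingHom_apply, map_mul]
    refine mul_ne_zero ?_ ?_
    · intro h0
      have hm : h ∈ RingHom.ker (p.evalRingHom ↑U' hp) := h0
      rw [hker] at hm
      exact hh hm
    · intro h0
      have hm : (g₁ : Γ(X.left, ↑U')) ∈ RingHom.ker (p.evalRingHom ↑U' hp) := h0
      rw [hker] at hm
      exact g₁.2 hm
  · calc s * (h * g₁) = h * (s * g₁) := by ring
      _ = h * (a₁ * ∏ j, t' j ^ k' j) := hhsec
      _ = h * a₁ * ∏ j, t' j ^ k' j := by ring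

/-- Pointwise form of `exists_mul_eq_mul_prod_pow` at the real points of `U'`. [folklore] -/
theorem eval_mul_eq_of_mul_eq {U' : X.left.Opens} {s num den : Γ(X.left, U')}
    {t' : Fin n → Γ(X.left, U')} {k : Fin n → ℕ} (h : s * den = num * ∏ j, t' j ^ k j)
    (Q : AlgPoints X ℝ) (hQ : Q.pt ∈ U') :
    Q.eval U' hQ s * Q.eval U' hQ den = Q.eval U' hQ num * ∏ j, Q.eval U' hQ (t' j) ^ k j := by
  have := congrArg (Q.evalRingHom U' hQ) h
  simpa only [map_mul, map_prod, map_pow, AlgPoints.evalRingHom_apply] using this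

end Monomial

end RealPoints

end Literature.AlgebraicGeometry.RealAlgebraic

end
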